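import Summits.Ventures.HodgeRepro2.T6A2Shadow

/-!
# T6A3ShadowFix — the `B × B` identification data of the A2 glue WITHOUT the spanning clause

Cell pub-hodge-repro2, Tier 6 (README §10), seat t6-p3 (A3 owner), on the lead's word (ruling R9, STATUS
l. 4994 (2), option (a)). Definition lane (one structure + one def) + one theorem; no display.

`A2Shadow.IdentBB.span_tensor` («`H^{even}(B × B)` is spanned by `pr₁^*a ∪ pr₂^*b` with `a`, `b` even»)
is false on the true `B × B` — `H¹(B) ⊗ H¹(B) ⊂ H²(B × B)` is a Künneth summand outside that span, and
`m^*` does not preserve the even ⊗ even subalgebra (`m^*(α ∧ β) = αβ ⊗ 1 + α ⊗ β − β ⊗ α + 1 ⊗ αβ`) — so the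
structure cannot be instantiated on the host geometry, while the only thing it was used for
(`IdentBB.intBB_evBB`, hence `exists_pont_char`) is the IDENTITY `intBB (evBB w) = ∫_{B×B} w`, which IS
true (both sides kill every bidegree ≠ (24, 24)). `IdentBB'` below is `IdentBB` with `span_tensor`
replaced by that identity as a field `int_evBB` (Layer III discharges it from graded commutativity +
Künneth (E2 / E3, `T6.Hyp.Hatcher_Thm3_11` / `Hyp.Bredon_VI_3_2_Kunneth`) and the product orientation), and
`exists_pont_char'` is t6-p2's `exists_pont_char` with the span induction removed. Nothing of T6A2Shadow
is re-typed or removed; the consumers (`ShadowData` via `alg_pont_even`) switch to `IdentBB'` by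
renaming.

§8(d): uses an L-value-free non-vanishing device: NO.
-/

namespace Summit.Ventures.HodgeRepro2.T6.A3ShadowFix

open Summit.Ventures.HodgeRepro2.T6 Summit.Ventures.HodgeRepro2.T6.A2Gysin
  Summit.Ventures.HodgeRepro2.T6.A2Shadow

universe u

variable {𝒞 : CycleTheory.{u}} {σ : A2Situation 𝒞} {K : Type*} [Field K] [NumberField K]

/-- THE MODEL IDENTIFICATION DATA, part 2 (repaired) — repairs `A2Shadow.IdentBB.span_tensor`, false on
the true `B × B`: `H¹ ⊗ H¹ ⊂ H²(B × B)` lies outside the even ⊗ even span and `m^*` does not preserve it —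
R9, STATUS l. 4966 / l. 4667 (3). `IdentBB'` is `A2Shadow.IdentBB` with the spanning clause replaced by the
identification of the integrals, `int_evBB : ∀ w, intBB (evBB w) = ∫_{B×B} w` — for the model's `intBB`
given as a parameter (the lead's `OfData.intBBOf K intB`); Layer III discharges `int_evBB` from E2 + E3
(`Hyp.Hatcher_Thm3_11` / `Hyp.Bredon_VI_3_2_Kunneth`) and the product orientation. -/
structure IdentBB' (I : IdentB σ K) (hPD : 𝒞.PoincareDuality) (intBB : HBB K →ₗ[ℚ] ℚ) where
  /-- `H^{even}(B × B, ℚ) → H^*(B, ℚ) ᵍ⊗ H^*(B, ℚ)` -/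
  evBB : 𝒞.H σ.BB →ₐ[ℚ] HBB K
  /-- `pr₁^* ↦ inl` -/
  ev_pr1 : ∀ a, evBB (𝒞.pull σ.pr1 a) = inl K (I.ev a)
  /-- `pr₂^* ↦ inr` -/
  ev_pr2 : ∀ a, evBB (𝒞.pull σ.pr2 a) = inr K (I.ev a)
  /-- the identification of the integrals: the model's `∫_{B×B}` read through `evBB` is the carrier's
  `∫_{B×B}` (true on the real geometry: both kill every bidegree ≠ (24, 24); Layer III discharges it from
  E2 + E3 + the product orientation) -/
  int_evBB : ∀ w, intBB (evBB w) = 𝒞.integral σ.BB w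
  /-- the even-part retraction of `ev` -/
  ψ : HB K →ₗ[ℚ] 𝒞.H σ.B
  /-- `ψ ∘ ev = id` -/
  ψ_ev : ∀ a, ψ (I.ev a) = a
  /-- `ev ∘ ψ = id` on even degrees -/
  ev_ψ_even : ∀ j, ∀ u ∈ degB K (2 * j), I.ev (ψ u) = u
  /-- `ψ` kills the odd degrees -/
  ψ_odd : ∀ j, ∀ u ∈ degB K (2 * j + 1), ψ u = 0
  /-- `∫_B` kills the even degrees ≠ 24 -/
  int_deg : ∀ j ≠ 12, ∀ u ∈ degB K (2 * j), 𝒞.integral σ.B (ψ u) = 0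
  /-- `∫_B ≠ 0` on the top degree -/
  int_ne_zero : ∃ u ∈ degB K 24, 𝒞.integral σ.B (ψ u) ≠ 0
  /-- the degree of the Pontryagin product -/
  pont_deg : ∀ (k l : ℕ) (a b : 𝒞.H σ.B), I.ev a ∈ degB K (2 * k) → I.ev b ∈ degB K (2 * l) →
    I.ev (σ.pont hPD a b) ∈ degB K (2 * (k + l - 12))

namespace IdentBB'

variable {I : IdentB σ K} {hPD : 𝒞.PoincareDuality} {intBB : HBB K →ₗ[ℚ] ℚ} (J : IdentBB' I hPD intBB)

/-- `∫_B` on the model: `intB := ∫_B ∘ ψ`. -/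
noncomputable def intBOf : HB K →ₗ[ℚ] ℚ := (𝒞.integral σ.B).comp J.ψ

/-- THE EVEN-DEGREE CHARACTERISATION OF THE PONTRYAGIN PRODUCT OF TWO ALGEBRAIC CLASSES (t6-p2's
`A2Shadow.IdentBB.exists_pont_char` without the span induction): for `a ∈ Alg k`, `b ∈ Alg l` there is
an algebraic `p ∈ Alg (k + l − 12)` with `∫_B p ∪ u = intBB ((a ⊗ b) ∪ m^*u)` for every even `u`, where
`intBB` is the model's `∫_{B×B}` identified with the carrier's by `int_evBB`. -/
theorem exists_pont_char' (hCap : 𝒞.BredonCapProduct) (hAug : 𝒞.AugmentationNatural)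
    (hF1 : 𝒞.FultonProperPushForward) (hR : 𝒞.FultonCycleClassRingHom)
    (cop : HB K →ₐ[ℚ] HBB K) (hcop_ev : ∀ a, J.evBB (𝒞.pull σ.m a) = cop (I.ev a))
    {k l : ℕ} {a b : HB K} (ha : a ∈ I.algOf k) (hb : b ∈ I.algOf l) :
    ∃ p ∈ I.algOf (k + l - 12), ∀ (j : ℕ) (u : HB K), u ∈ degB K (2 * j) →
      J.intBOf (p * u) = intBB (inl K a * inr K b * cop u) := by
  obtain ⟨a', ha', rfl⟩ := IdentBB.exists_mem_Alg_of_mem_span ha.1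
  obtain ⟨b', hb', rfl⟩ := IdentBB.exists_mem_Alg_of_mem_span hb.1
  refine ⟨I.ev (σ.pont hPD a' b'), ⟨Submodule.subset_span ⟨_, σ.pont_mem_Alg hPD hF1 hR ha' hb', rfl⟩,
    J.pont_deg k l a' b' ha.2 hb.2⟩, ?_⟩
  intro j u hu
  have hu' : I.ev (J.ψ u) = u := J.ev_ψ_even j u hu
  have hmul : I.ev (σ.pont hPD a' b') * u = I.ev (σ.pont hPD a' b' * J.ψ u) := by
    rw [map_mul, hu']
  calc J.intBOf (I.ev (σ.pont hPD a' b') * u)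
      = 𝒞.integral σ.B (σ.pont hPD a' b' * J.ψ u) := by
        rw [hmul]
        simp only [intBOf, LinearMap.comp_apply]
        rw [J.ψ_ev]
    _ = 𝒞.integral σ.BB (σ.tensor a' b' * 𝒞.pull σ.m (J.ψ u)) := by
        rw [A2Situation.pont, CycleTheory.integral_gysin_mul hPD hCap hAug]
    _ = intBB (J.evBB (σ.tensor a' b' * 𝒞.pull σ.m (J.ψ u))) := by
        rw [J.int_evBB]
    _ = intBB (inl K (I.ev a') * inr K (I.ev b') * cop u) := by
        rw [map_mul, hcop_ev, hu']
        congr 2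
        simp only [A2Situation.tensor]
        rw [map_mul, J.ev_pr1, J.ev_pr2]

end IdentBB'

end Summit.Ventures.HodgeRepro2.T6.A3ShadowFix
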